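import Literature.Probability.LatticeModels.EdgeKilledBeurling
import Literature.Probability.LatticeModels.KilledWalkHubFactorisation
import Literature.Probability.LatticeModels.BoxChainManeuver
import HarnessLib

/-!
# The inward annulus maneuver for the edge-killed walk (line `symplectic-fermion-anchor`,
crux `SAWLoopFugacityFlow.AvoidanceLimit`, stmt-CriticalPhenomena-10649, stub W7)

`edgeKilled_hitProb_inner_le`: there is a universal `cin > 0` such that for every Jordan domain `D`,
mesh `δ > 0`, boundary point `p ∈ ∂D` read in the open box of radius `12k` about `c` on `δℤ²`
(`k ≥ 1`), finite region `Λ` and site `x` off the box of radius `24k`, the walk along the kept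
edges of `Ω^δ = discreteDomainGraph D δ` (killed at its first non-kept step and on leaving `Λ`) hits
the start box `mB c k` (radius `12k`) with probability at most `1 - cin`: the one-scale weak
Beurling estimate of Smirnov (2010), Lemma B.2 (after Kesten) / Chelkak (2016), Lemma 2.11, run
inside out (cf. the outward `JordanDomain.edgeKilled_survive_le`, `EdgeKilledAnnulusManeuver.lean`).

Proof. (0) `hitProb` is killed-harmonic on `Λ ∖ sqBox c (24k)`; by the maximum principle it is
bounded there by its values at sites off `Λ` (value `0`) and on the layer `20k ≤ |y - c|_∞ ≤ 28k`,
the union of four bands. (1) At a band point run a thirteen-step circuit design read off a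
twelve-periodic table (the circuit part of the landed `maneuver` and its quarter-turn images; the
four designs are the cyclic shifts of the table, the last step crosses the starting strip
completely, all rectangles miss `mB c k`, the first start set contains the band). (II) The free
chain is at least the tail product (`BoxChain.tailConst_zero_le_chainM`). (III')
**`M - Nᵉ ≤ 1 - hitProb`** (maximum principle for the killed walk,
`chainM_sub_chainNE_le_one_sub_hitProb`). (I) `Nᵉ = 0`: a positive edge-killed chain yields kept
walks performing the steps, four of which cross the four frame strips — impossible around a boundary
point (`JordanDomain.false_of_keptCrossings`). [cite: Smirnov2010, Lemma B.2; Chelkak2016, Lemma 2.11]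
-/

noncomputable section

open scoped BigOperators Classical
open Set SimpleGraph
open Literature.Probability.LatticeModels
open Literature.Probability.RandomPlanarGeometry (JordanDomain)

namespace Summit.CriticalPhenomena.SAWScalingLimit.Theorems.AvoidanceLimit.Anchor

/-- **`M_j - Nᵉ_j ≤ 1 - hitProb` everywhere.** For a design whose rectangles `U i` (finite) miss
`B`, the free chain minus the edge-killed chain is at most the probability of NOT hitting `B` before
leaving the finite region `Λ` along kept edges (analytic strong Markov property: induction on `j`,
maximum principle for the killed-subharmonic `M - Nᵉ - (1 - hitProb)` on `U i ∩ Λ`). [folklore] -/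
theorem chainM_sub_chainNE_le_one_sub_hitProb {G : SimpleGraph (Site 2)} {U L : ℕ → Set (Site 2)} {n : ℕ}
    (hU : ∀ i, (U i).Finite) {Λ B : Set (Site 2)} (hΛ : Λ.Finite) (hUB : ∀ i, Disjoint (U i) B)
    (j : ℕ) (x : Site 2) : chainM U L n j x - chainNE G U L n j x ≤ 1 - hitProb G Λ B x := by
  induction j generalizing x with
  | zero => simp only [chainM, chainNE, sub_self]; linarith [hitProb_le_one (Gr := G) (B := B) hΛ x]
  | succ j ih =>
    set i := n - 1 - j with hi
    set gM : Site 2 → ℝ := fun w => if w ∈ L i then chainM U L n j w else 0 with hgM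
    set gN : Site 2 → ℝ := fun w => if w ∈ L i then chainNE G U L n j w else 0 with hgN
    have hM : chainM U L n (j + 1) = harmExt (U i) gM := rfl
    have hN : chainNE G U L n (j + 1) = killedHarmExt G (U i) gN := rfl
    have hs1 : ∀ y, hitProb G Λ B y ≤ 1 := fun y => hitProb_le_one hΛ y
    have hM1 : ∀ y, chainM U L n (j + 1) y ≤ 1 := fun y => (chainM_mem_Icc hU (j + 1) y).2
    have hN0 : ∀ y, 0 ≤ chainNE G U L n (j + 1) y := fun y => (chainNE_mem_Icc hU (j + 1) y).1
    -- the claim off `U i`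
    have hoff : ∀ y, y ∉ U i → chainM U L n (j + 1) y - chainNE G U L n (j + 1) y ≤ 1 - hitProb G Λ B y := by
      intro y hy
      rw [hN, killedHarmExt_of_not_mem _ hy, hM, harmExt_of_not_mem (hU i) _ hy, hgM, hgN]
      simp only
      by_cases hyL : y ∈ L i
      · simp only [hyL, if_true]; exact ih y
      · simp only [hyL, if_false, sub_zero]; linarith [hs1 y]
    -- the claim on `U i` off `Λ`: there `hitProb = 0`
    have hoffΛ : ∀ y, y ∈ U i → y ∉ Λ →
        chainM U L n (j + 1) y - chainNE G U L n (j + 1) y ≤ 1 - hitProb G Λ B y := by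
      intro y hyU hyΛ
      have hyB : y ∉ B := fun h => Set.disjoint_left.1 (hUB i) hyU h
      rw [hitProb_of_not_mem (fun h => hyΛ h.1), if_neg hyB]
      linarith [hM1 y, hN0 y]
    by_cases hx : x ∈ U i ∩ Λ
    · -- inside: `F = M - Nᵉ - (1 - hitProb)` is killed-subharmonic on `U i ∩ Λ`
      set F : Site 2 → ℝ := fun y => chainM U L n (j + 1) y - chainNE G U L n (j + 1) y - (1 - hitProb G Λ B y)
        with hF
      have hfin : (U i ∩ Λ).Finite := (hU i).subset inter_subset_left
      have hsub : IsKilledSubharmonicOn G F (U i ∩ Λ) := by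
        intro y hy
        have h1 : chainM U L n (j + 1) y = 4⁻¹ * ∑ e : SRW.Dir 2, chainM U L n (j + 1) (y + SRW.stepVec e) := by
          rw [hM]; exact eq_avg_of_isLatticeHarmonicOn (harmExt_harmonicOn (hU i) gM) hy.1
        have h2 : chainNE G U L n (j + 1) y = killedAvg G (chainNE G U L n (j + 1)) y := by
          rw [hN]; exact killedHarmExt_harmonicOn (hU i) gN y hy.1
        have h3 : hitProb G Λ B y = killedAvg G (hitProb G Λ B) y :=
          hitProb_harmonicOn hΛ y ⟨hy.2, fun h => Set.disjoint_left.1 (hUB i) hy.1 h⟩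
        simp only [hF, killedAvg] at h2 h3 ⊢
        rw [h1, h2, h3]
        rw [Finset.mul_sum, Finset.mul_sum, Finset.mul_sum, Finset.mul_sum]
        have h4 : (1 : ℝ) = ∑ e : SRW.Dir 2, (4⁻¹ : ℝ) := by
          simp [Finset.card_univ]
        conv_lhs => rw [show (1 : ℝ) - ∑ e : SRW.Dir 2, 4⁻¹ * (if G.Adj y (y + SRW.stepVec e) then hitProb G Λ B (y + SRW.stepVec e) else 0) =
          ∑ e : SRW.Dir 2, (4⁻¹ - 4⁻¹ * (if G.Adj y (y + SRW.stepVec e) then hitProb G Λ B (y + SRW.stepVec e) else 0)) by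
          rw [Finset.sum_sub_distrib, ← h4]]
        rw [← Finset.sum_sub_distrib, ← Finset.sum_sub_distrib]
        refine Finset.sum_le_sum fun e _ => ?_
        by_cases ha : G.Adj y (y + SRW.stepVec e)
        · simp only [ha, if_true]; linarith
        · simp only [ha, if_false, mul_zero, sub_zero]
          linarith [hM1 (y + SRW.stepVec e)]
      have key := hsub.le_of_forall_boundary_le hfin (M := 0) le_rfl (fun w hw => by
        have hw' : w ∉ U i ∩ Λ := hw.1
        simp only [hF]
        by_cases hwU : w ∈ U i
        · linarith [hoffΛ w hwU (fun h => hw' ⟨hwU, h⟩)]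
        · linarith [hoff w hwU]) x hx
      simp only [hF] at key
      linarith
    · by_cases hxU : x ∈ U i
      · exact hoffΛ x hxU (fun h => hx ⟨hxU, h⟩)
      · exact hoff x hxU

/-- One step of the edge-killed maneuver of a box-chain design along kept edges. [folklore] -/
theorem iter_stepE_box {G : SimpleGraph (Site 2)} {D : ℕ → MStep} {n : ℕ} {c : ℕ → Site 2} {k : ℕ}
    {i : ℕ} (hi : i < n) {y : Site 2} (hy : y ∈ BoxChain.bU D n c k i)
    (hpos : 0 < chainNE G (BoxChain.bU D n c k) (BoxChain.bL D n c k) n (n - i) y) :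
    ∃ y', y' ∈ BoxChain.bL D n c k i ∧ 0 < chainNE G (BoxChain.bU D n c k) (BoxChain.bL D n c k) n (n - 1 - i) y' ∧
      ∃ p : G.Walk y y', ∀ z ∈ p.support, z ∈ BoxChain.bU D n c k i ∨ z = y' := by
  have e1 : n - 1 - (n - 1 - i) = i := by omega
  have e2 : n - i = (n - 1 - i) + 1 := by omega
  rw [e2] at hpos
  simp only [chainNE, e1] at hpos
  obtain ⟨w, -, hwpos, p, hp⟩ := exists_walk_of_killedHarmExt_pos (BoxChain.bU_finite D n c k i) hy hpos
  split_ifs at hwpos with hw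
  · exact ⟨w, hw, hwpos, p, hp⟩
  · exact absurd hwpos (lt_irrefl 0)

/-- **Landing points and kept walks of a positive edge-killed chain.** If `Nᵉ_n x > 0` at
`x ∈ T 0` (with `L i ⊆ T (i+1)`), there are landing points `y_1, …, y_n` (`y_i ∈ L (i-1)`, `y_0 = x`)
and walks `y_i → y_{i+1}` along `G`-edges with supports in `U i ∪ {y_{i+1}}`. [folklore] -/
theorem exists_landingsE {G : SimpleGraph (Site 2)} {D : ℕ → MStep} {n : ℕ} {c : ℕ → Site 2} {k : ℕ}
    (hLT : ∀ i, i + 1 < n → (D i).L (c i) k ⊆ (D (i + 1)).T (c (i + 1)) k)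
    {x : Site 2} (hx : x ∈ BoxChain.bT D n c k 0)
    (hpos : 0 < chainNE G (BoxChain.bU D n c k) (BoxChain.bL D n c k) n n x) :
    ∃ ys : ℕ → Site 2, ys 0 = x ∧ (∀ i < n, ys (i + 1) ∈ BoxChain.bL D n c k i) ∧
      ∀ i < n, ∃ p : G.Walk (ys i) (ys (i + 1)), ∀ z ∈ p.support, z ∈ BoxChain.bU D n c k i ∨ z = ys (i + 1) := by
  have main : ∀ m ≤ n, ∃ ys : ℕ → Site 2, ys 0 = x ∧ (∀ i < m, ys (i + 1) ∈ BoxChain.bL D n c k i) ∧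
      (∀ i < m, ∃ p : G.Walk (ys i) (ys (i + 1)), ∀ z ∈ p.support, z ∈ BoxChain.bU D n c k i ∨ z = ys (i + 1)) ∧
      0 < chainNE G (BoxChain.bU D n c k) (BoxChain.bL D n c k) n (n - m) (ys m) ∧ ys m ∈ BoxChain.bT D n c k m := by
    intro m
    induction m with
    | zero =>
      exact fun _ => ⟨fun _ => x, rfl, fun i hi => absurd hi (Nat.not_lt_zero i),
        fun i hi => absurd hi (Nat.not_lt_zero i), by rwa [Nat.sub_zero], hx⟩
    | succ m ih =>
      intro hm
      obtain ⟨ys, h0, hL, hW, hpos', hT'⟩ := ih (by omega)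
      have hm' : m < n := by omega
      obtain ⟨y', hy'L, hy'pos, p, hp⟩ := iter_stepE_box hm' (BoxChain.bT_subset_bU hm' hT') hpos'
      set ys' : ℕ → Site 2 := fun i => if i ≤ m then ys i else y' with hys'
      have hle : ∀ i ≤ m, ys' i = ys i := fun i hi => if_pos hi
      have hsucc : ys' (m + 1) = y' := if_neg (by omega)
      refine ⟨ys', by rw [hle 0 (Nat.zero_le _), h0], fun i hi => ?_, fun i hi => ?_, ?_, ?_⟩
      · rcases Nat.lt_succ_iff_lt_or_eq.1 hi with hi | rfl
        · rw [hle (i + 1) hi]; exact hL i hi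
        · rw [hsucc]; exact hy'L
      · rcases Nat.lt_succ_iff_lt_or_eq.1 hi with hi | rfl
        · obtain ⟨q, hq⟩ := hW i hi
          refine ⟨q.copy (hle i hi.le).symm (hle (i + 1) hi).symm, ?_⟩
          rw [Walk.support_copy, hle (i + 1) hi]; exact hq
        · refine ⟨p.copy (hle i le_rfl).symm hsucc.symm, ?_⟩
          rw [Walk.support_copy, hsucc]; exact hp
      · rw [hsucc, show n - (m + 1) = n - 1 - m by omega]; exact hy'pos
      · rw [hsucc]
        by_cases hm1 : m + 1 < n
        · rw [BoxChain.bT_of_lt hm1]; rw [BoxChain.bL_of_lt hm'] at hy'L; exact hLT m hm1 hy'L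
        · simp [BoxChain.bT, hm1]
  obtain ⟨ys, h0, hL, hW, -, -⟩ := main n le_rfl
  exact ⟨ys, h0, hL, hW⟩

/-- **The circuit table and its design checks.** The twelve-periodic table of steps (units of `k`
about `c`, format `MStep`): entries `0–9` are steps `2–11` of `maneuver` (cross the top strip
left→right, turn over the top-right corner, cross the right strip downwards, turn, cross the bottom
strip right→left, turn, cross the left strip upwards), entries `10, 11` the quarter-turn images
closing the circuit in the top-left corner (the table is invariant under the clockwise quarter turn
`⟨α, β, w, h, s⟩ ↦ ⟨β, -α-w, h, w, s-1⟩ composed with the shift by three). Checks (by `omega`):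
widths and heights are `≥ 8`, each landing set lies in the next start set (cyclically), and the
open rectangles miss the start box `mB c k`. [folklore] -/
theorem circuit_checks {c : Site 2} {k : ℕ} (hk : 0 < k) (j : Fin 12) :
    let T : Fin 12 → MStep := ![⟨-46, 12, 86, 24, 0⟩, ⟨36, 6, 8, 35, 1⟩, ⟨24, 37, 22, 8, 2⟩, ⟨12, -40, 24, 86, 3⟩,
      ⟨6, -44, 35, 8, 0⟩, ⟨37, -46, 8, 22, 1⟩, ⟨-40, -36, 86, 24, 2⟩, ⟨-44, -41, 8, 35, 3⟩, ⟨-46, -45, 22, 8, 0⟩,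
      ⟨-36, -46, 24, 86, 1⟩, ⟨-41, 36, 35, 8, 2⟩, ⟨-45, 24, 8, 22, 3⟩]
    (8 ≤ (T j).w ∧ 8 ≤ (T j).h) ∧ (T j).L c k ⊆ (T (j + 1)).T c k ∧ Disjoint ((T j).U c k) (mB c k) := by
  intro T
  refine ⟨?_, fun x hx => ?_, Set.disjoint_left.2 fun x hxU hxB => ?_⟩
  · fin_cases j <;> simp [T]
  · fin_cases j <;>
      simp only [T, MStep.L, MStep.T, MStep.U, MStep.corner, rectInterior, Set.mem_setOf_eq,
        Matrix.cons_val_zero, Matrix.cons_val_one] at hx ⊢ <;>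
      simp at hx ⊢ <;> omega
  · obtain ⟨hb0, hb1⟩ := hxB
    rw [abs_le] at hb0 hb1
    fin_cases j <;>
      simp only [T, MStep.U, MStep.corner, rectInterior, Set.mem_setOf_eq,
        Matrix.cons_val_zero, Matrix.cons_val_one] at hxU <;>
      simp at hxU <;> omega

/-- **Four kept strip crossings from the landing data.** If the landing points and kept walks of a
box-chain design about the constant centre `c` are given, and four of its steps (each preceded by
the corresponding turn step of the circuit table) are the four strip-crossing steps of the table,
then there are walks along `G`-edges across the four frame strips in the format of
`JordanDomain.false_of_keptCrossings`: top strip `c₁ + 12k ≤ z₁ ≤ c₁ + 36k` from `z₀ ≤ c₀ - 36k` to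
`z₀ ≥ c₀ + 36k`, and similarly for the right, bottom and left strips. [folklore] -/
theorem keptCrossings_of_landings {G : SimpleGraph (Site 2)} {D : ℕ → MStep} {n : ℕ} {c : Site 2} {k : ℕ}
    {ys : ℕ → Site 2} (hL : ∀ i < n, ys (i + 1) ∈ BoxChain.bL D n (fun _ => c) k i)
    (hW : ∀ i < n, ∃ p : G.Walk (ys i) (ys (i + 1)),
      ∀ z ∈ p.support, z ∈ BoxChain.bU D n (fun _ => c) k i ∨ z = ys (i + 1))
    {i₀ i₁ i₂ i₃ : ℕ} (hi : (0 < i₀ ∧ i₀ < n) ∧ (0 < i₁ ∧ i₁ < n) ∧ (0 < i₂ ∧ i₂ < n) ∧ (0 < i₃ ∧ i₃ < n))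
    (hD : (D (i₀ - 1) = ⟨-45, 24, 8, 22, 3⟩ ∧ D i₀ = ⟨-46, 12, 86, 24, 0⟩) ∧
      (D (i₁ - 1) = ⟨24, 37, 22, 8, 2⟩ ∧ D i₁ = ⟨12, -40, 24, 86, 3⟩) ∧
      (D (i₂ - 1) = ⟨37, -46, 8, 22, 1⟩ ∧ D i₂ = ⟨-40, -36, 86, 24, 2⟩) ∧
      (D (i₃ - 1) = ⟨-46, -45, 22, 8, 0⟩ ∧ D i₃ = ⟨-36, -46, 24, 86, 1⟩)) :
    (∃ (u v : Site 2) (σ : G.Walk u v), (∃ z ∈ σ.support, z 0 ≤ c 0 - 36 * k) ∧ (∃ z ∈ σ.support, c 0 + 36 * k ≤ z 0) ∧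
      ∀ z ∈ σ.support, c 1 + 12 * k ≤ z 1 ∧ z 1 ≤ c 1 + 36 * k) ∧
    (∃ (u v : Site 2) (σ : G.Walk u v), (∃ z ∈ σ.support, z 1 ≤ c 1 - 36 * k) ∧ (∃ z ∈ σ.support, c 1 + 36 * k ≤ z 1) ∧
      ∀ z ∈ σ.support, c 0 + 12 * k ≤ z 0 ∧ z 0 ≤ c 0 + 36 * k) ∧
    (∃ (u v : Site 2) (σ : G.Walk u v), (∃ z ∈ σ.support, z 0 ≤ c 0 - 36 * k) ∧ (∃ z ∈ σ.support, c 0 + 36 * k ≤ z 0) ∧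
      ∀ z ∈ σ.support, c 1 - 36 * k ≤ z 1 ∧ z 1 ≤ c 1 - 12 * k) ∧
    (∃ (u v : Site 2) (σ : G.Walk u v), (∃ z ∈ σ.support, z 1 ≤ c 1 - 36 * k) ∧ (∃ z ∈ σ.support, c 1 + 36 * k ≤ z 1) ∧
      ∀ z ∈ σ.support, c 0 - 36 * k ≤ z 0 ∧ z 0 ≤ c 0 - 12 * k) := by
  -- the start point, end point and support of the walk of a crossing step
  have data : ∀ {i : ℕ} (hi0 : 0 < i) (hin : i < n) (s t : MStep), D (i - 1) = s → D i = t →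
      ys i ∈ s.L c k ∧ ys (i + 1) ∈ t.L c k ∧
        ∃ p : G.Walk (ys i) (ys (i + 1)), ∀ z ∈ p.support, z ∈ t.U c k ∨ z = ys (i + 1) := by
    intro i hi0 hin s t hs ht
    have h1 := hL (i - 1) (by omega)
    rw [Nat.sub_add_cancel hi0, BoxChain.bL_of_lt (by omega : i - 1 < n), hs] at h1
    have h2 := hL i hin
    rw [BoxChain.bL_of_lt hin, ht] at h2
    obtain ⟨p, hp⟩ := hW i hin
    rw [BoxChain.bU_of_lt hin, ht] at hp
    exact ⟨h1, h2, p, hp⟩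
  obtain ⟨hs₀, he₀, p₀, hp₀⟩ := data hi.1.1 hi.1.2 _ _ hD.1.1 hD.1.2
  obtain ⟨hs₁, he₁, p₁, hp₁⟩ := data hi.2.1.1 hi.2.1.2 _ _ hD.2.1.1 hD.2.1.2
  obtain ⟨hs₂, he₂, p₂, hp₂⟩ := data hi.2.2.1.1 hi.2.2.1.2 _ _ hD.2.2.1.1 hD.2.2.1.2
  obtain ⟨hs₃, he₃, p₃, hp₃⟩ := data hi.2.2.2.1 hi.2.2.2.2 _ _ hD.2.2.2.1 hD.2.2.2.2
  simp only [MStep.L, MStep.U, MStep.corner, rectInterior, Set.mem_setOf_eq, Matrix.cons_val_zero,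
    Matrix.cons_val_one] at hs₀ he₀ hp₀ hs₁ he₁ hp₁ hs₂ he₂ hp₂ hs₃ he₃ hp₃
  simp at hs₀ he₀ hp₀ hs₁ he₁ hp₁ hs₂ he₂ hp₂ hs₃ he₃ hp₃
  refine ⟨⟨_, _, p₀, ⟨_, p₀.start_mem_support, by omega⟩, ⟨_, p₀.end_mem_support, by omega⟩, fun z hz => ?_⟩,
    ⟨_, _, p₁, ⟨_, p₁.end_mem_support, by omega⟩, ⟨_, p₁.start_mem_support, by omega⟩, fun z hz => ?_⟩,
    ⟨_, _, p₂, ⟨_, p₂.end_mem_support, by omega⟩, ⟨_, p₂.start_mem_support, by omega⟩, fun z hz => ?_⟩,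
    ⟨_, _, p₃, ⟨_, p₃.start_mem_support, by omega⟩, ⟨_, p₃.end_mem_support, by omega⟩, fun z hz => ?_⟩⟩
  · rcases hp₀ z hz with h | rfl <;> omega
  · rcases hp₁ z hz with h | rfl <;> omega
  · rcases hp₂ z hz with h | rfl <;> omega
  · rcases hp₃ z hz with h | rfl <;> omega

/-- **The inward maneuver on the four bands.** A universal `cin > 0` such that, if a boundary point
`p ∈ ∂D` lies in the open box of radius `12k` about `c` (read on `δℤ²`), then at every site `y` of the
layer `20k ≤ |y - c|_∞ ≤ 28k` and for every finite `Λ`, the edge-killed walk of `Ω^δ` killed on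
leaving `Λ` hits `mB c k` with probability `≤ 1 - cin` (steps (1), (II), (III'), (I) of the module
docstring, for the cyclic shift of the table whose first start set contains the band of `y`).
[cite: Smirnov2010, Lemma B.2; Chelkak2016, Lemma 2.11] -/
theorem hitProb_le_of_mem_layer :
    ∃ cin : ℝ, 0 < cin ∧ ∀ (D : JordanDomain) (δ : ℝ), 0 < δ → ∀ p ∈ frontier D.carrier,
      ∀ (c : Site 2) (k : ℕ), 0 < k → |p.re / δ - c 0| < 12 * k → |p.im / δ - c 1| < 12 * k →
      ∀ (Λ : Set (Site 2)), Λ.Finite → ∀ y : Site 2, |y 0 - c 0| ≤ 28 * k → |y 1 - c 1| ≤ 28 * k →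
        (20 * (k : ℤ) ≤ |y 0 - c 0| ∨ 20 * (k : ℤ) ≤ |y 1 - c 1|) →
        hitProb (discreteDomainGraph D.carrier δ) Λ (mB c k) y ≤ 1 - cin := by
  -- the circuit table and its four cyclic shifts (thirteen steps each)
  set TAB : Fin 12 → MStep := ![⟨-46, 12, 86, 24, 0⟩, ⟨36, 6, 8, 35, 1⟩, ⟨24, 37, 22, 8, 2⟩, ⟨12, -40, 24, 86, 3⟩,
    ⟨6, -44, 35, 8, 0⟩, ⟨37, -46, 8, 22, 1⟩, ⟨-40, -36, 86, 24, 2⟩, ⟨-44, -41, 8, 35, 3⟩, ⟨-46, -45, 22, 8, 0⟩,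
    ⟨-36, -46, 24, 86, 1⟩, ⟨-41, 36, 35, 8, 2⟩, ⟨-45, 24, 8, 22, 3⟩] with hTAB
  set Dr : ℕ → ℕ → MStep := fun r m => TAB ⟨(m + 3 * r) % 12, Nat.mod_lt _ (by norm_num)⟩ with hDr
  have hwh : ∀ r, ∀ i < 13, 8 ≤ (Dr r i).w ∧ 8 ≤ (Dr r i).h := fun r i _ => (circuit_checks (c := 0) one_pos _).1
  have ht0 : ∀ r, 0 < BoxChain.tailConst (Dr r) 13 0 := fun r => BoxChain.tailConst_pos
    (fun i hi => ⟨lt_of_lt_of_le (by norm_num) (hwh r i hi).1, lt_of_lt_of_le (by norm_num) (hwh r i hi).2⟩) 0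
  refine ⟨min (min (BoxChain.tailConst (Dr 0) 13 0) (BoxChain.tailConst (Dr 1) 13 0))
    (min (BoxChain.tailConst (Dr 2) 13 0) (BoxChain.tailConst (Dr 3) 13 0)),
    lt_min (lt_min (ht0 0) (ht0 1)) (lt_min (ht0 2) (ht0 3)), ?_⟩
  intro D δ hδ p hp c k hk hp0 hp1 Λ hΛ y hy0 hy1 hlayer
  set G := discreteDomainGraph D.carrier δ with hG
  -- design checks at `(c, k)`
  have hLT : ∀ r i, i + 1 < 13 → (Dr r i).L c k ⊆ (Dr r (i + 1)).T c k := by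
    intro r i _
    have h := (circuit_checks (c := c) hk ⟨(i + 3 * r) % 12, Nat.mod_lt _ (by norm_num)⟩).2.1
    have e : (⟨(i + 3 * r) % 12, Nat.mod_lt _ (by norm_num)⟩ : Fin 12) + 1 =
        ⟨(i + 1 + 3 * r) % 12, Nat.mod_lt _ (by norm_num)⟩ := Fin.ext (by rw [Fin.val_add]; simp; omega)
    rw [e] at h; exact h
  have hUB : ∀ r i, Disjoint (BoxChain.bU (Dr r) 13 (fun _ => c) k i) (mB c k) := by
    intro r i
    by_cases hi : i < 13
    · rw [BoxChain.bU_of_lt hi]; exact (circuit_checks hk _).2.2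
    · simp [BoxChain.bU, hi]
  -- the estimate on the first start set of the shift `r`
  have key : ∀ r < 4, ∀ z ∈ (Dr r 0).T c k, hitProb G Λ (mB c k) z ≤ 1 - BoxChain.tailConst (Dr r) 13 0 := by
    intro r hr z hz
    have hzT : z ∈ BoxChain.bT (Dr r) 13 (fun _ => c) k 0 := by rw [BoxChain.bT_of_lt (by norm_num)]; exact hz
    have hII := BoxChain.tailConst_zero_le_chainM (c := fun _ => c) hk (hwh r) (fun i hi => hLT r i hi) hzT
    have hIII := chainM_sub_chainNE_le_one_sub_hitProb (G := G) (L := BoxChain.bL (Dr r) 13 (fun _ => c) k) (n := 13)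
      (BoxChain.bU_finite (Dr r) 13 (fun _ => c) k) hΛ (hUB r) 13 z
    have hI : chainNE G (BoxChain.bU (Dr r) 13 (fun _ => c) k) (BoxChain.bL (Dr r) 13 (fun _ => c) k) 13 13 z = 0 := by
      by_contra hne
      have hpos := lt_of_le_of_ne (chainNE_mem_Icc (BoxChain.bU_finite (Dr r) 13 (fun _ => c) k) 13 z).1 (Ne.symm hne)
      obtain ⟨ys, -, hL, hW⟩ := exists_landingsE (G := G) (fun i hi => hLT r i hi) hzT hpos
      interval_cases r
      · obtain ⟨hT, hR, hB, hL'⟩ := keptCrossings_of_landings hL hW (i₀ := 12) (i₁ := 3) (i₂ := 6) (i₃ := 9)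
          (by norm_num) ⟨⟨rfl, rfl⟩, ⟨rfl, rfl⟩, ⟨rfl, rfl⟩, ⟨rfl, rfl⟩⟩; exact D.false_of_keptCrossings hδ hk hp hp0 hp1 hT hR hB hL'
      · obtain ⟨hT, hR, hB, hL'⟩ := keptCrossings_of_landings hL hW (i₀ := 9) (i₁ := 12) (i₂ := 3) (i₃ := 6)
          (by norm_num) ⟨⟨rfl, rfl⟩, ⟨rfl, rfl⟩, ⟨rfl, rfl⟩, ⟨rfl, rfl⟩⟩; exact D.false_of_keptCrossings hδ hk hp hp0 hp1 hT hR hB hL'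
      · obtain ⟨hT, hR, hB, hL'⟩ := keptCrossings_of_landings hL hW (i₀ := 6) (i₁ := 9) (i₂ := 12) (i₃ := 3)
          (by norm_num) ⟨⟨rfl, rfl⟩, ⟨rfl, rfl⟩, ⟨rfl, rfl⟩, ⟨rfl, rfl⟩⟩; exact D.false_of_keptCrossings hδ hk hp hp0 hp1 hT hR hB hL'
      · obtain ⟨hT, hR, hB, hL'⟩ := keptCrossings_of_landings hL hW (i₀ := 3) (i₁ := 6) (i₂ := 9) (i₃ := 12)
          (by norm_num) ⟨⟨rfl, rfl⟩, ⟨rfl, rfl⟩, ⟨rfl, rfl⟩, ⟨rfl, rfl⟩⟩; exact D.false_of_keptCrossings hδ hk hp hp0 hp1 hT hR hB hL'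
    linarith
  have hmin : ∀ r < 4, min (min (BoxChain.tailConst (Dr 0) 13 0) (BoxChain.tailConst (Dr 1) 13 0))
      (min (BoxChain.tailConst (Dr 2) 13 0) (BoxChain.tailConst (Dr 3) 13 0)) ≤ BoxChain.tailConst (Dr r) 13 0 := by
    intro r hr
    interval_cases r <;> simp only [min_le_iff, le_refl, true_or, or_true]
  -- locate the band of `y` and conclude
  have e0 : Dr 0 0 = ⟨-46, 12, 86, 24, 0⟩ := rfl
  have e1 : Dr 1 0 = ⟨12, -40, 24, 86, 3⟩ := rfl
  have e2 : Dr 2 0 = ⟨-40, -36, 86, 24, 2⟩ := rfl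
  have e3 : Dr 3 0 = ⟨-36, -46, 24, 86, 1⟩ := rfl
  rw [abs_le] at hy0 hy1
  rcases hlayer with h | h <;> rw [le_abs] at h <;> rcases h with h | h
  · refine (key 1 (by norm_num) y ?_).trans (by linarith [hmin 1 (by norm_num)])
    simp only [e1, MStep.T, MStep.U, MStep.corner, rectInterior, Set.mem_setOf_eq, Matrix.cons_val_zero,
      Matrix.cons_val_one]; simp; omega
  · refine (key 3 (by norm_num) y ?_).trans (by linarith [hmin 3 (by norm_num)])
    simp only [e3, MStep.T, MStep.U, MStep.corner, rectInterior, Set.mem_setOf_eq, Matrix.cons_val_zero,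
      Matrix.cons_val_one]; simp; omega
  · refine (key 0 (by norm_num) y ?_).trans (by linarith [hmin 0 (by norm_num)])
    simp only [e0, MStep.T, MStep.U, MStep.corner, rectInterior, Set.mem_setOf_eq, Matrix.cons_val_zero,
      Matrix.cons_val_one]; simp; omega
  · refine (key 2 (by norm_num) y ?_).trans (by linarith [hmin 2 (by norm_num)])
    simp only [e2, MStep.T, MStep.U, MStep.corner, rectInterior, Set.mem_setOf_eq, Matrix.cons_val_zero,
      Matrix.cons_val_one]; simp; omega

/-- **The inward annulus maneuver for the edge-killed walk (one scale, every lattice scale).**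
There is a universal `cin > 0` such that for every Jordan domain `D`, mesh `δ > 0`, boundary point
`p ∈ ∂D` in the open box of radius `12k` about `c` (read on `δℤ²`, `k ≥ 1`), finite region `Λ` and
site `x` off the box of radius `24k` about `c`, the walk along the kept edges of `Ω^δ`, killed at its
first non-kept step and on leaving `Λ`, hits the box `mB c k` of radius `12k` with probability
`≤ 1 - cin`. Reduction (0) of the module docstring (maximum principle on `Λ ∖ sqBox c (24k)`) to
`hitProb_le_of_mem_layer`. [cite: Smirnov2010, Lemma B.2; Chelkak2016, Lemma 2.11] -/
theorem edgeKilled_hitProb_inner_le :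
    ∃ cin : ℝ, 0 < cin ∧ ∀ (D : JordanDomain) (δ : ℝ), 0 < δ → ∀ p ∈ frontier D.carrier,
      ∀ (c : Site 2) (k : ℕ), 0 < k → |p.re / δ - c 0| < 12 * k → |p.im / δ - c 1| < 12 * k →
      ∀ (Λ : Set (Site 2)), Λ.Finite → ∀ x : Site 2, x ∉ WeakBeurling.sqBox c (24 * k) →
        hitProb (discreteDomainGraph D.carrier δ) Λ (mB c k) x ≤ 1 - cin := by
  obtain ⟨cin, hcin, hband⟩ := hitProb_le_of_mem_layer
  refine ⟨cin, hcin, ?_⟩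
  intro D δ hδ p hp c k hk hp0 hp1 Λ hΛ x hx
  set G := discreteDomainGraph D.carrier δ with hG
  have hk' : (0 : ℤ) < k := by exact_mod_cast hk
  have hlay := hband D δ hδ p hp c k hk hp0 hp1 Λ hΛ
  -- `0 ≤ 1 - cin`, from the estimate at a band point
  have h01 : 0 ≤ 1 - cin := by
    have habs : |(24 : ℤ) * k| = 24 * k := abs_of_nonneg (by omega)
    have h := hlay (![c 0, c 1 + 24 * k]) (by simp) (by simp [habs]; omega) (Or.inr (by simp [habs]; omega))
    exact (hitProb_nonneg hΛ _).trans h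
  have hBbox : ∀ z ∈ mB c k, z ∈ WeakBeurling.sqBox c (24 * k) := by
    intro z hz
    obtain ⟨h0, h1⟩ := hz
    rw [WeakBeurling.mem_sqBox]
    constructor <;> linarith
  by_cases hxΛ : x ∈ Λ
  swap
  · rw [hitProb_of_not_mem (fun h => hxΛ h.1), if_neg (fun h => hx (hBbox x h))]; exact h01
  -- maximum principle on `Λ ∖ sqBox c (24k)`
  set R : Set (Site 2) := Λ \ WeakBeurling.sqBox c (24 * k) with hR
  have hRfin : R.Finite := hΛ.subset fun _ hz => hz.1
  have hharm : IsKilledHarmonicOn G (hitProb G Λ (mB c k)) R :=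
    (hitProb_harmonicOn hΛ).mono fun z hz => ⟨hz.1, fun hzB => hz.2 (hBbox z hzB)⟩
  refine hharm.le_of_forall_boundary_le hRfin h01 (fun w hw => ?_) x ⟨hxΛ, hx⟩
  obtain ⟨hwR, v, hv, e, rfl, -⟩ := hw
  have he0 := SRW.abs_stepVec_apply_le e 0
  have he1 := SRW.abs_stepVec_apply_le e 1
  have hv2 := hv.2
  rw [WeakBeurling.mem_sqBox, not_and_or, not_le, not_le] at hv2
  rw [abs_le] at he0 he1
  by_cases hwΛ : v + SRW.stepVec e ∈ Λ
  · -- a site of `Λ` next to the outside of the box: it lies in the layer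
    have hwbox : v + SRW.stepVec e ∈ WeakBeurling.sqBox c (24 * k) := by
      by_contra h; exact hwR ⟨hwΛ, h⟩
    rw [WeakBeurling.mem_sqBox] at hwbox
    obtain ⟨hb0, hb1⟩ := hwbox
    refine hlay _ (hb0.trans (by omega)) (hb1.trans (by omega)) ?_
    simp only [Pi.add_apply] at hb0 hb1 ⊢
    rw [abs_le] at hb0 hb1
    rcases hv2 with h | h <;> rw [lt_abs] at h
    · left; rw [le_abs]; rcases h with h | h <;> [left; right] <;> omega
    · right; rw [le_abs]; rcases h with h | h <;> [left; right] <;> omega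
  · -- a site off `Λ`: `hitProb` is the indicator of `mB c k`, i.e. `0`
    rw [hitProb_of_not_mem (fun h => hwΛ h.1), if_neg]
    · exact h01
    · rintro ⟨hb0, hb1⟩
      simp only [Pi.add_apply] at hb0 hb1
      rw [abs_le] at hb0 hb1
      rcases hv2 with h | h <;> rw [lt_abs] at h <;> omega

end Summit.CriticalPhenomena.SAWScalingLimit.Theorems.AvoidanceLimit.Anchor

end
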